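import Summits.Ventures.AbcSig.Rows.TemplateC
import Summits.Ventures.AbcSig.Rows.XTemplateB

/-!
# Venture AbcSig — EXTENDED-EXCLUSION twin of `Rows/TemplateC.lean` (`xⁿ + yⁿ = C z²`, levels `2C²` / `32C²`)

HONEST FRAMING. Template file of a COMPUTATION cell (`pub-abcsig`); CONDITIONAL theorems, no claim on ABC or any
summit. Each theorem `xrow_template_*` below is the theorem `row_template_*` of `Rows/TemplateC.lean` with ONE change:
the per-orbit alternative of the level hypothesis reads
`o.Eliminated bs04Allowed n ∨ (M.Excludes N o fam ∨ M.ExcludesStd N o n)` instead of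
`o.Eliminated bs04Allowed n ∨ M.Excludes N o fam`, where `M.ExcludesStd N o n` (`Recipes/EisPackage.lean`) says that no
STANDING datum with exponent `n` has its mod-`n` representation arising from a newform matching `o` — the shape in
which the cell's module-M6 (Eisenstein congruence, `NewformModel.excludesStd_of_m6`) and module-M6χ (Eisenstein
congruence with a character pair, `NewformModel.excludesStd_of_m6chi`) certificates are discharged by the kernel. The
elementary reductions are those of `TemplateC.lean` verbatim ([BS04, Lemma 2.1/3.2]: `xy` even ⇒ case (v₇) at level
`2C²` after a swap and a sign change; `xy` odd ⇒ case (i) at level `32C²` by `case_i_or_swap`); the final step is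
`xno_solution_in_case` (`Rows/XTemplateB.lean`). Used by the C1 rows of the cell's A11-1 list (`xⁿ + yⁿ = C z²`,
`xy` even, `C ∈ {23, 37, 43, 47, 53, 59}`) whose last residual exponent is closed by an M6χ certificate.

Reference: [BS04] M. A. Bennett, C. M. Skinner, Canad. J. Math. 56 (2004) 23–54, §§2–5.
-/

namespace Summit.Ventures.AbcSig

/-- **Row template, `xy` even, extended per-orbit alternative.** For odd squarefree `C`, a prime `n ≥ 7` with
`n ∤ C`, and the cell's hypotheses at level `2C²` for this `n` (package; data; per orbit a kernel certificate, a cited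
family exclusion for "`(1, 1, C)`, exponent `n`, `xy` even", or a standing-datum exclusion `ExcludesStd`), there is no
primitive solution of `xⁿ + yⁿ = C z²` with `xy` even. -/
theorem xrow_template_even (C : ℕ) (hsq : Squarefree C) (hCodd : Odd C) (M : NewformModel)
    (hP : M.BS04Package) {orbsE : List OrbitData} (hDE : M.DataComplete (2 * C ^ 2) orbsE)
    (n : ℕ) (hn : n.Prime) (h7 : 7 ≤ n) (hnC : ¬ n ∣ C)
    (hE : ∀ o ∈ orbsE, (∀ e ∈ o.coeffs, e.ell.Prime ∧ e.ell ≠ 2 ∧ ¬ e.ell ∣ 2 * C ^ 2) ∧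
      (o.Eliminated bs04Allowed n ∨ (M.Excludes (2 * C ^ 2) o
        (fun S => S.A = 1 ∧ S.B = 1 ∧ S.C = C ∧ S.n = n ∧ 2 ∣ S.a * S.b) ∨ M.ExcludesStd (2 * C ^ 2) o n)))
    (a b c : ℤ) (heven : 2 ∣ a * b) : ¬ IsPrimitiveSolution 1 1 C n a b c := by
  intro hsol
  have hCpos : 0 < C := hCodd.pos
  have hCoddZ : ¬ 2 ∣ (C : ℤ) := by
    intro h
    have h' : (2 : ℕ) ∣ C := by exact_mod_cast h
    exact (Nat.not_even_iff_odd.mpr hCodd) (even_iff_two_dvd.mpr h')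
  -- WLOG `b` even
  obtain ⟨a', b', hsol', hb', hab'⟩ :
      ∃ a' b' : ℤ, IsPrimitiveSolution 1 1 C n a' b' c ∧ 2 ∣ b' ∧ a' * b' = a * b := by
    rcases Int.prime_two.dvd_mul.mp heven with h2 | h2
    · exact ⟨b, a, hsol.swap, h2, mul_comm _ _⟩
    · exact ⟨a, b, hsol, h2, rfl⟩
  -- `c` odd, sign of `c`
  have hc2 : ¬ 2 ∣ c := by
    intro h2c
    obtain ⟨-, -, -, -, -, -, hbc⟩ := hsol'
    have hu := hbc.isUnit_of_dvd' (by simpa using hb') (Dvd.dvd.mul_left h2c _)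
    rcases Int.isUnit_iff.mp hu with h | h <;> omega
  obtain ⟨c', hc'sgn, hc'⟩ := exists_sign_sub_four_dvd c C hc2 hCoddZ
  have hsol'' : IsPrimitiveSolution 1 1 C n a' b' c' := hsol'.of_sign hc'sgn
  have hcase : FreyCase.Holds .v₇ 1 1 C n a' b' c' := by
    refine ⟨?_, hc'⟩
    have h2n : (2 : ℤ) ^ 7 ∣ b' ^ n := (pow_dvd_pow 2 h7).trans (pow_dvd_pow_of_dvd hb' n)
    simpa using h2n
  have hndvd : ¬ n ∣ 1 * 1 * C := by simpa using hnC
  have hfree : ∀ q : ℕ, q.Prime → ¬ q ^ n ∣ 1 ∧ ¬ q ^ n ∣ 1 := by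
    intro q hq
    have : ¬ q ^ n ∣ 1 := by
      intro h
      have h1 := Nat.dvd_one.mp h
      rw [Nat.pow_eq_one] at h1
      rcases h1 with h1 | h1
      · exact hq.one_lt.ne' h1
      · omega
    exact ⟨this, this⟩
  have hab1 : a' * b' ≠ 1 := by
    intro h; rw [h] at hab'; omega
  have hab2 : a' * b' ≠ -1 := by
    intro h; rw [h] at hab'; omega
  have heven' : 2 ∣ a' * b' := by rw [hab']; exact heven
  exact xno_solution_in_case M hP ⟨1, 1, C, n, a', b', c'⟩ .v₇ (2 * C ^ 2) one_pos one_pos hCpos hsq hn h7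
    hndvd hfree hsol'' hab1 hab2 hcase (bs04Level_one_one C n hsq hCodd hnC).1 hDE
    (fun S => S.A = 1 ∧ S.B = 1 ∧ S.C = C ∧ S.n = n ∧ 2 ∣ S.a * S.b) ⟨rfl, rfl, rfl, rfl, heven'⟩ hE

/-- **Row template, `xy` odd, extended per-orbit alternative.** For odd squarefree `C ≥ 3`, a prime `n ≥ 7` with
`n ∤ C`, and the cell's hypotheses at level `32C²` for this `n` (family "`(1, 1, C)`, exponent `n`, `xy` odd"; per
orbit a kernel certificate, a cited family exclusion, or `ExcludesStd`), there is no primitive solution with `xy` odd. -/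
theorem xrow_template_odd (C : ℕ) (hC3 : 3 ≤ C) (hsq : Squarefree C) (hCodd : Odd C) (M : NewformModel)
    (hP : M.BS04Package) {orbsO : List OrbitData} (hDO : M.DataComplete (32 * C ^ 2) orbsO)
    (n : ℕ) (hn : n.Prime) (h7 : 7 ≤ n) (hnC : ¬ n ∣ C)
    (hO : ∀ o ∈ orbsO, (∀ e ∈ o.coeffs, e.ell.Prime ∧ e.ell ≠ 2 ∧ ¬ e.ell ∣ 32 * C ^ 2) ∧
      (o.Eliminated bs04Allowed n ∨ (M.Excludes (32 * C ^ 2) o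
        (fun S => S.A = 1 ∧ S.B = 1 ∧ S.C = C ∧ S.n = n ∧ ¬ 2 ∣ S.a * S.b) ∨ M.ExcludesStd (32 * C ^ 2) o n)))
    (a b c : ℤ) (hodd : ¬ 2 ∣ a * b) : ¬ IsPrimitiveSolution 1 1 C n a b c := by
  intro hsol
  have hCpos : 0 < C := hCodd.pos
  have hnodd : Odd n := hn.odd_of_ne_two (by omega)
  have hCoddZ : ¬ 2 ∣ (C : ℤ) := by
    intro h
    have h' : (2 : ℕ) ∣ C := by exact_mod_cast h
    exact (Nat.not_even_iff_odd.mpr hCodd) (even_iff_two_dvd.mpr h')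
  -- the trivial candidates
  have heq : a ^ n + b ^ n = C * c ^ 2 := by simpa using hsol.1
  have hCc : (C : ℤ) * c ≠ 0 := by simpa using hsol.2.2.2.1
  by_cases htriv : a * b = 1 ∨ a * b = -1
  · exact no_trivial_solution C hC3 n hnodd a b c htriv hCc heq
  have hab1 : a * b ≠ 1 := fun h => htriv (Or.inl h)
  have hab2 : a * b ≠ -1 := fun h => htriv (Or.inr h)
  -- `a b A B C` odd
  have hodd5 : ¬ 2 ∣ a * b * (1 : ℕ) * (1 : ℕ) * (C : ℕ) := by
    intro h
    have h' : (2 : ℤ) ∣ a * b * C := by simpa using h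
    rcases Int.prime_two.dvd_mul.mp h' with h2 | h2
    · exact hodd h2
    · exact hCoddZ h2
  have hndvd : ¬ n ∣ 1 * 1 * C := by simpa using hnC
  have hfree : ∀ q : ℕ, q.Prime → ¬ q ^ n ∣ 1 ∧ ¬ q ^ n ∣ 1 := by
    intro q hq
    have : ¬ q ^ n ∣ 1 := by
      intro h
      have h1 := Nat.dvd_one.mp h
      rw [Nat.pow_eq_one] at h1
      rcases h1 with h1 | h1
      · exact hq.one_lt.ne' h1
      · omega
    exact ⟨this, this⟩
  have hL := (bs04Level_one_one C n hsq hCodd hnC).2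
  let fam : FreyDatum → Prop := fun S => S.A = 1 ∧ S.B = 1 ∧ S.C = C ∧ S.n = n ∧ ¬ 2 ∣ S.a * S.b
  rcases case_i_or_swap hsol hnodd hodd5 with hcase | hcase
  · exact xno_solution_in_case M hP ⟨1, 1, C, n, a, b, c⟩ .i (32 * C ^ 2) one_pos one_pos hCpos hsq hn h7 hndvd
      hfree hsol hab1 hab2 hcase hL hDO fam ⟨rfl, rfl, rfl, rfl, hodd⟩ hO
  · have hodd' : ¬ 2 ∣ b * a := by rw [mul_comm]; exact hodd
    have hba1 : b * a ≠ 1 := by rw [mul_comm]; exact hab1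
    have hba2 : b * a ≠ -1 := by rw [mul_comm]; exact hab2
    exact xno_solution_in_case M hP ⟨1, 1, C, n, b, a, c⟩ .i (32 * C ^ 2) one_pos one_pos hCpos hsq hn h7 hndvd
      hfree hsol.swap hba1 hba2 hcase hL hDO fam ⟨rfl, rfl, rfl, rfl, hodd'⟩ hO

/-- **Row template, both parities, extended per-orbit alternative.** For odd squarefree `C ≥ 3` and a prime `n ≥ 7`,
`n ∤ C`: the hypotheses of `xrow_template_even` (level `2C²`) and `xrow_template_odd` (level `32C²`) together give:
NO primitive solution of `xⁿ + yⁿ = C z²`. -/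
theorem xrow_template (C : ℕ) (hC3 : 3 ≤ C) (hsq : Squarefree C) (hCodd : Odd C) (M : NewformModel)
    (hP : M.BS04Package) {orbsE orbsO : List OrbitData} (hDE : M.DataComplete (2 * C ^ 2) orbsE)
    (hDO : M.DataComplete (32 * C ^ 2) orbsO) (n : ℕ) (hn : n.Prime) (h7 : 7 ≤ n) (hnC : ¬ n ∣ C)
    (hE : ∀ o ∈ orbsE, (∀ e ∈ o.coeffs, e.ell.Prime ∧ e.ell ≠ 2 ∧ ¬ e.ell ∣ 2 * C ^ 2) ∧
      (o.Eliminated bs04Allowed n ∨ (M.Excludes (2 * C ^ 2) o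
        (fun S => S.A = 1 ∧ S.B = 1 ∧ S.C = C ∧ S.n = n ∧ 2 ∣ S.a * S.b) ∨ M.ExcludesStd (2 * C ^ 2) o n)))
    (hO : ∀ o ∈ orbsO, (∀ e ∈ o.coeffs, e.ell.Prime ∧ e.ell ≠ 2 ∧ ¬ e.ell ∣ 32 * C ^ 2) ∧
      (o.Eliminated bs04Allowed n ∨ (M.Excludes (32 * C ^ 2) o
        (fun S => S.A = 1 ∧ S.B = 1 ∧ S.C = C ∧ S.n = n ∧ ¬ 2 ∣ S.a * S.b) ∨ M.ExcludesStd (32 * C ^ 2) o n)))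
    (a b c : ℤ) : ¬ IsPrimitiveSolution 1 1 C n a b c := by
  by_cases hpar : 2 ∣ a * b
  · exact xrow_template_even C hsq hCodd M hP hDE n hn h7 hnC hE a b c hpar
  · exact xrow_template_odd C hC3 hsq hCodd M hP hDO n hn h7 hnC hO a b c hpar

end Summit.Ventures.AbcSig
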